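import Literature.Computability.Complexity.HiraharaSpecConst
import Literature.Computability.Complexity.CMMSAFromLabelCover
import Literature.Computability.Complexity.MCSPHardnessFromTwoFacts
import Literature.Computability.MetaComplexity.PromiseRandReductionsCounting
import HarnessLib

/-!
# `MCSP*` from a polynomial-time implementation of Hirahara's reduction

Topic `Computability/Complexity`. The assembly step between the mathematical correctness of
Hirahara's reduction `HiraharaRed.redOut c I₀ r` (`HiraharaSpec.lean`: `redOut_mem_of_yes`,
`card_redOut_mem_mul_three_le`; `HiraharaSpecConst.lean`: `card_redOut_mem_mul_three_le_const`)
and the randomized reductions it is meant to establish, stated relative to an IMPLEMENTATION of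
`redOut c` — a polynomial-time string function `F` on the pair codes `⟨code I₀, r⟩`
(`boolPair`, coins of the prescribed length) together with a polynomial coin budget `q`
dominating `totCoins` — exactly the data consumed by the constructor
`promiseRandReducible_of_cnt` (`PromiseRandReductionsCounting.lean`; Arora–Barak's normal form
`M(x, r)`, Def. 7.3). Given such an implementation:

* `HiraharaRed.promiseRandReducible_gapCMMSA_const_of_pairFn` — for `c ≥ 1`, `g₀ ≥ 107520`,
  `ε₀ ≤ 1`: `PromiseRandReducible (gapCMMSA g₀ ε₀ sqrtLog) (ofLanguage MCSP*)` (Lemma 8.3 /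
  Thm. 8.5 at a constant gap — the hypothesis `h83` of `isRandNPHard_MCSPStar_of_raz`);
* `HiraharaRed.promiseRandReducible_gapCMMSA_rpow_of_pairFn` — for `α > 0`, `c ≥ 1` with
  `c^α ≥ 107520`: the same for `gapCMMSA (Δ^α) (Δ^{-α}) sqrtLog`; hence
  `Hirahara2022_gapCMMSA_randReducible_MCSPStar_of_pairFn` — the named fact
  `Hirahara2022_gapCMMSA_randReducible_MCSPStar` (`MCSPHardnessProofs.lean`) from implementations
  of `redOut c` for all `c ≥ 1` (take `c = ⌈107520^{1/α}⌉ + 1`);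
* `isRandNPHard_MCSPStar_of_raz_of_pairFn` — **`isRandNPHard_MCSPStar` from Raz's theorem
  (Arora–Barak 2009, Thm. 22.15, displayed hypothesis) and an implementation of `redOut 1`**;
  `isRandNPHard_MCSPStar_of_pcp_of_pairFn` — from the sliding-scale PCP fact
  `Hirahara2022_lem53_logPow_queried` and implementations of `redOut c` for all `c ≥ 1`.

Yes side: every coin string is good (`redOut_mem_of_yes`), so `cnt = 2^{q|x|}`. No side: the
good coin strings are those with `redOut ∉ MCSP*`, at least two thirds by the soundness theorems
(`cnt E + cnt Eᶜ = 2^{q|x|}`).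

## References

* S. Hirahara, *NP-hardness of learning programs and partial MCSP*, ECCC TR22-119, Lemma 8.3
  and the proof of Thm. 8.5 (`MCSP*` case, pp. 30–31) [Hirahara2022PartialMCSP].
* S. Arora, B. Barak, *Computational Complexity: A Modern Approach*, CUP 2009, Def. 7.3,
  Def. 7.16 and §7.6; Thm. 22.15 [AroraBarak2009].
-/

namespace Literature.Computability.Complexity

open _root_.Computability MetaComplexity
open Literature.Computability.MetaComplexity.CMMSA (yesSet noSet)

namespace HiraharaRed

section Assembly

open scoped Classical

variable {c : ℕ} {F : List Bool → List Bool} {q : Polynomial ℕ}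

/-- The event "the implementation's output is in `E`" has the count of the event "`redOut ∈ E`"
over coin strings of the prescribed length. [folklore] -/
theorem cnt_pairFn_eq {m : ℕ} {x : List Bool} {I₀ : CMMSAInstance}
    (hFq : ∀ r : List Bool, r.length = m → F (boolPair x r) = redOut c I₀ r) (E : Set (List Bool)) :
    cnt m {r | F (boolPair x r) ∈ E} = cnt m {r | redOut c I₀ r ∈ E} :=
  cnt_congr fun r hr => by simp [hFq r hr]

/-- `cnt m {r | redOut c I₀ r ∈ MCSP*}` is the cardinality bounded by the soundness theorems.
[folklore] -/
theorem cnt_redOut_eq (m : ℕ) (I₀ : CMMSAInstance) :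
    cnt m {r | redOut c I₀ r ∈ MCSPStar} =
      ((Finset.univ : Finset (List.Vector Bool m)).filter
        fun r : List.Vector Bool m => redOut c I₀ r.toList ∈ MCSPStar).card := by
  unfold cnt
  rfl

/-- **Yes side**: on a yes-instance every coin string of the prescribed length is good.
[cite: Hirahara2022PartialMCSP, proof of Thm. 8.5 (completeness, probability 1)] -/
theorem two_mul_le_cnt_yes (hc : 1 ≤ c) {m : ℕ} {x : List Bool} {I₀ : CMMSAInstance}
    (hI₀ : I₀ ∈ yesSet sqrtLog) (hFq : ∀ r : List Bool, r.length = m → F (boolPair x r) = redOut c I₀ r) :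
    2 * 2 ^ m ≤ 3 * cnt m {r | F (boolPair x r) ∈ (PromiseProblem.ofLanguage MCSPStar).yes} := by
  rw [cnt_eq_two_pow_of_forall]
  · omega
  · intro r hr
    show F (boolPair x r) ∈ MCSPStar
    rw [hFq r hr]
    exact redOut_mem_of_yes hc hI₀ r

/-- **No side (abstract)**: if at most a third of the coin strings of the prescribed length `m`
put `redOut` into `MCSP*`, then at least two thirds are good for the complement. [folklore] -/
theorem two_mul_le_cnt_no {m : ℕ} {x : List Bool} {I₀ : CMMSAInstance}
    (hFq : ∀ r : List Bool, r.length = m → F (boolPair x r) = redOut c I₀ r)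
    (h3 : ((Finset.univ : Finset (List.Vector Bool m)).filter
        fun r : List.Vector Bool m => redOut c I₀ r.toList ∈ MCSPStar).card * 3 ≤ 2 ^ m) :
    2 * 2 ^ m ≤ 3 * cnt m {r | F (boolPair x r) ∈ (PromiseProblem.ofLanguage MCSPStar).no} := by
  have h1 : cnt m {r | F (boolPair x r) ∈ (PromiseProblem.ofLanguage MCSPStar).no} =
      cnt m {r | redOut c I₀ r ∈ MCSPStar}ᶜ := by
    refine cnt_congr fun r hr => ?_
    change F (boolPair x r) ∉ MCSPStar ↔ redOut c I₀ r ∉ MCSPStar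
    rw [hFq r hr]
  have h2 := cnt_add_cnt_compl m {r | redOut c I₀ r ∈ MCSPStar}
  rw [cnt_redOut_eq] at h2
  rw [h1]
  omega

/-- **Lemma 8.3 / Thm. 8.5 at a constant gap, from an implementation of `redOut c`.** For `c ≥ 1`,
`g₀ ≥ 107520`, `ε₀ ≤ 1`, a string function `F ∈ FP` agreeing with `redOut c I₀ r` on the pair
codes `⟨code I₀, r⟩` for coin strings of the prescribed length `q(|code I₀|) ≥ totCoins`
gives `PromiseRandReducible (gapCMMSA g₀ ε₀ sqrtLog) (ofLanguage MCSP*)`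
(`promiseRandReducible_of_cnt` with `redOut_mem_of_yes` and `card_redOut_mem_mul_three_le_const`).
[cite: Hirahara2022PartialMCSP, Lemma 8.3 and proof of Thm. 8.5 (MCSP* case, pp. 30–31), at a constant gap] -/
theorem promiseRandReducible_gapCMMSA_const_of_pairFn (hc : 1 ≤ c) {g₀ ε₀ : ℝ}
    (hg₀ : (107520 : ℝ) ≤ g₀) (hε₀ : ε₀ ≤ 1) (hF : F ∈ FP)
    (hFq : ∀ (I₀ : CMMSAInstance) (r : List Bool),
      r.length = q.eval (CMMSAInstance.encoding.encode I₀).length →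
        F (boolPair (CMMSAInstance.encoding.encode I₀) r) = redOut c I₀ r)
    (hq : ∀ I₀ : CMMSAInstance, I₀.WellFormed →
      (Pre.toPInst I₀).totCoins ≤ q.eval (CMMSAInstance.encoding.encode I₀).length) :
    PromiseRandReducible (gapCMMSA (fun _ => g₀) (fun _ => ε₀) sqrtLog)
      (PromiseProblem.ofLanguage MCSPStar) := by
  refine promiseRandReducible_of_cnt hF q (fun x hx => ?_) (fun x hx => ?_)
  · rw [gapCMMSA_yes] at hx
    obtain ⟨I₀, hI₀, rfl⟩ := hx
    exact two_mul_le_cnt_yes hc hI₀ (hFq I₀)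
  · rw [gapCMMSA_no] at hx
    obtain ⟨I₀, hI₀, rfl⟩ := hx
    exact two_mul_le_cnt_no (hFq I₀)
      (card_redOut_mem_mul_three_le_const hg₀ hε₀ hc hI₀ (hq I₀ hI₀.1))

/-- **Lemma 8.3 / Thm. 8.5 on the promise of Thm. 5.2, from an implementation of `redOut c`.**
For `α > 0` and `c ≥ 1` with `c^α ≥ 107520`, an implementation of `redOut c` as above gives
`PromiseRandReducible (gapCMMSA (Δ^α) (Δ^{-α}) sqrtLog) (ofLanguage MCSP*)`
(`card_redOut_mem_mul_three_le`). [cite: Hirahara2022PartialMCSP, Lemma 8.3 and proof of Thm. 8.5 (MCSP* case, pp. 30–31)] -/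
theorem promiseRandReducible_gapCMMSA_rpow_of_pairFn {α : ℝ} (hα : 0 < α) (hc : 1 ≤ c)
    (hcα : (107520 : ℝ) ≤ (c : ℝ) ^ α) (hF : F ∈ FP)
    (hFq : ∀ (I₀ : CMMSAInstance) (r : List Bool),
      r.length = q.eval (CMMSAInstance.encoding.encode I₀).length →
        F (boolPair (CMMSAInstance.encoding.encode I₀) r) = redOut c I₀ r)
    (hq : ∀ I₀ : CMMSAInstance, I₀.WellFormed →
      (Pre.toPInst I₀).totCoins ≤ q.eval (CMMSAInstance.encoding.encode I₀).length) :
    PromiseRandReducible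
      (gapCMMSA (fun n => (sqrtLog n : ℝ) ^ α) (fun n => (sqrtLog n : ℝ) ^ (-α)) sqrtLog)
      (PromiseProblem.ofLanguage MCSPStar) := by
  refine promiseRandReducible_of_cnt hF q (fun x hx => ?_) (fun x hx => ?_)
  · rw [gapCMMSA_yes] at hx
    obtain ⟨I₀, hI₀, rfl⟩ := hx
    exact two_mul_le_cnt_yes hc hI₀ (hFq I₀)
  · rw [gapCMMSA_no] at hx
    obtain ⟨I₀, hI₀, rfl⟩ := hx
    exact two_mul_le_cnt_no (hFq I₀)
      (card_redOut_mem_mul_three_le hα hc hcα hI₀ (hq I₀ hI₀.1))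

end Assembly

/-- For `α > 0` there is a threshold constant `c ≥ 1` with `c^α ≥ 107520`
(`c = ⌈107520^{1/α}⌉ + 1`). [cite: Hirahara2022PartialMCSP, proof of Thm. 8.5 ("if g is larger than some constant")] -/
theorem exists_threshold_const {α : ℝ} (hα : 0 < α) :
    ∃ c : ℕ, 1 ≤ c ∧ (107520 : ℝ) ≤ (c : ℝ) ^ α := by
  refine ⟨⌈(107520 : ℝ) ^ (1 / α)⌉₊ + 1, by omega, ?_⟩
  have h0 : (0 : ℝ) ≤ (107520 : ℝ) ^ (1 / α) := Real.rpow_nonneg (by norm_num) _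
  have hle : (107520 : ℝ) ^ (1 / α) ≤ ((⌈(107520 : ℝ) ^ (1 / α)⌉₊ + 1 : ℕ) : ℝ) := by
    push_cast
    exact (Nat.le_ceil _).trans (le_add_of_nonneg_right zero_le_one)
  calc (107520 : ℝ) = ((107520 : ℝ) ^ (1 / α)) ^ α := by
        rw [← Real.rpow_mul (by norm_num), one_div_mul_cancel hα.ne', Real.rpow_one]
    _ ≤ ((⌈(107520 : ℝ) ^ (1 / α)⌉₊ + 1 : ℕ) : ℝ) ^ α := Real.rpow_le_rpow h0 hle hα.le

/-- **The named fact `Hirahara2022_gapCMMSA_randReducible_MCSPStar` from implementations of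
`redOut c` for all `c ≥ 1`.** [cite: Hirahara2022PartialMCSP, Lemma 8.3 and proof of Thm. 8.5 (MCSP* case, pp. 30–31)] -/
theorem Hirahara2022_gapCMMSA_randReducible_MCSPStar_of_pairFn
    (hM : ∀ c : ℕ, 1 ≤ c → ∃ F ∈ FP, ∃ q : Polynomial ℕ,
      (∀ (I₀ : CMMSAInstance) (r : List Bool),
        r.length = q.eval (CMMSAInstance.encoding.encode I₀).length →
          F (boolPair (CMMSAInstance.encoding.encode I₀) r) = redOut c I₀ r) ∧
      ∀ I₀ : CMMSAInstance, I₀.WellFormed →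
        (Pre.toPInst I₀).totCoins ≤ q.eval (CMMSAInstance.encoding.encode I₀).length) :
    Hirahara2022_gapCMMSA_randReducible_MCSPStar := by
  intro α hα
  obtain ⟨c, hc, hcα⟩ := exists_threshold_const hα
  obtain ⟨F, hF, q, hFq, hq⟩ := hM c hc
  exact promiseRandReducible_gapCMMSA_rpow_of_pairFn hα hc hcα hF hFq hq

/-- **`isRandNPHard_MCSPStar` from Raz's theorem and an implementation of `redOut 1`**: Arora–Barak
2009, Thm. 22.15 (displayed hypothesis, as in `AroraEtAl1997_prop6_of_raz`) gives NP-hard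
constant-gap CMMSA (`CMMSAFromLabelCover.lean`), and the implementation gives the randomized
reduction at the constant gap `g₀ = 107520`, `ε₀ = 1` (`promiseRandReducible_gapCMMSA_const_of_pairFn`).
[cite: Hirahara2022PartialMCSP, Thm. 8.5 (proof, pp. 30–31); AroraBarak2009, Thm. 22.15] -/
theorem isRandNPHard_MCSPStar_of_raz_of_pairFn
    (hraz : ∃ c : ℕ, 1 < c ∧ ∀ t : ℕ, 1 < t → (gapLabelCover (2 ^ (c * t)) (1 / 2 ^ t)).IsNPHard)
    (hM : ∃ F ∈ FP, ∃ q : Polynomial ℕ,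
      (∀ (I₀ : CMMSAInstance) (r : List Bool),
        r.length = q.eval (CMMSAInstance.encoding.encode I₀).length →
          F (boolPair (CMMSAInstance.encoding.encode I₀) r) = redOut 1 I₀ r) ∧
      ∀ I₀ : CMMSAInstance, I₀.WellFormed →
        (Pre.toPInst I₀).totCoins ≤ q.eval (CMMSAInstance.encoding.encode I₀).length) :
    isRandNPHard_MCSPStar := by
  obtain ⟨F, hF, q, hFq, hq⟩ := hM
  exact isRandNPHard_MCSPStar_of_raz hraz ⟨107520, 1, by norm_num, one_pos, le_rfl,
    promiseRandReducible_gapCMMSA_const_of_pairFn le_rfl le_rfl le_rfl hF hFq hq⟩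

/-- **`isRandNPHard_MCSPStar` from the sliding-scale PCP fact and implementations of `redOut c`
for all `c ≥ 1`** (`isRandNPHard_MCSPStar_of_pcp` with
`Hirahara2022_gapCMMSA_randReducible_MCSPStar_of_pairFn`). [cite: Hirahara2022PartialMCSP, Thm. 8.5 (proof, pp. 30–31) with Thm. 5.2 and Lemma 5.3] -/
theorem isRandNPHard_MCSPStar_of_pcp_of_pairFn (h53 : Hirahara2022_lem53_logPow_queried)
    (hM : ∀ c : ℕ, 1 ≤ c → ∃ F ∈ FP, ∃ q : Polynomial ℕ,
      (∀ (I₀ : CMMSAInstance) (r : List Bool),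
        r.length = q.eval (CMMSAInstance.encoding.encode I₀).length →
          F (boolPair (CMMSAInstance.encoding.encode I₀) r) = redOut c I₀ r) ∧
      ∀ I₀ : CMMSAInstance, I₀.WellFormed →
        (Pre.toPInst I₀).totCoins ≤ q.eval (CMMSAInstance.encoding.encode I₀).length) :
    isRandNPHard_MCSPStar :=
  isRandNPHard_MCSPStar_of_pcp h53 (Hirahara2022_gapCMMSA_randReducible_MCSPStar_of_pairFn hM)

end HiraharaRed

end Literature.Computability.Complexity
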